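import Summits.Ventures.HodgeRepro2.T5SchurIsotypicStep4

/-!
# T5IsotypicStep4Adelic — (A3) STEP 4 in its two-group form: «π₀ ⊂ L_{π_∞}» for a `G(𝔸)`-irreducible
`π₀` and the `G_∞`-isotypic parts

Cell pub-hodge-repro2, seat p5, Tier 5 (route/T5-N4-p5.md, N4.3 v13 (A3) STEP 4, l. 147): «Let
P_π : L → L_π be the orthogonal projection; by (α) it commutes with R(G(𝔸)), so A_π := P_π|_{π₀} ∈
R(π₀, L_π) for the irreducible unitary G(𝔸)-module π₀.  If A_π ≠ 0, [Bo72] 5.5 makes π₀ equivalent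
to a closed G(𝔸)-subrepresentation W of L_π, whence π₀|_{G_∞} ≅ W|_{G_∞} […].  If A_{π′} ≠ 0 as
well with π′ ≇ π, […] π ≅ π′: contradiction.  Since L = ⊕̂ L_π (γ) and π₀ ≠ 0, exactly one π_∞ ∈ Ĝ_∞
has A_{π_∞} ≠ 0, and […] π₀ ⊂ L_{π_∞}.»

Row 37 (`T5SchurIsotypicStep4.existsUnique_le_isotypic`) proves this for a `W₀` irreducible under
the SAME group whose copies define the isotypic parts.  In the prose the two groups differ: `π₀` is
irreducible under `G(𝔸)`, the isotypic parts are those of `G_∞ ⊂ G(𝔸)`, and the bridge is (α): every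
`L_π` is `G(𝔸)`-stable.  This file is STEP 4 in exactly that shape — a group `G` («G(𝔸)»), a group
`A` («G_∞») with a homomorphism `ι : A →* G`, a unitary `ρ : G →* (E →L[ℂ] E)`, the `A`-isotypic
parts `L π = closure (⨆ i, H π i)` of pairwise inequivalent irreducible unitary `σ π : A →* …`
(closed `ρ ∘ ι`-stable copies `H π i`), hypothesis (α) `hLs` (each `L π` is `ρ`-stable), and a
closed `ρ`-stable `W₀ ≠ ⊥` irreducible under `ρ` (the big group):

* `exists_linearIsometryEquiv_of_starProjection_ne_zero_big`: if `P_{L π}` and `P_{L π'}` are both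
  non-zero on `W₀`, then `σ π ≅ σ π'` — [Bo72] 5.5 for the big group (row 31) realises `W₀` inside
  `L π` and inside `L π'` as closed `ρ`-stable subspaces, and row 35 compares the two copies as
  `A`-representations;
* `existsUnique_starProjection_ne_zero_big`: exactly one `π` has `P_{L π}|_{W₀} ≠ 0`;
* **`existsUnique_le_isotypic_big`**: `W₀` lies in exactly one `L π` — «π₀ ⊂ L_{π_∞}» with the
  hypotheses of the prose;
* (α) itself for the CANONICAL isotypic part `isotypicPart ρA σ` (the closed span of ALL closed
  stable copies of `σ`): `map_mem_copies` (a unitary commuting with `ρA` maps copies to copies),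
  `isotypicPart_stable_of_comm`, and **`isotypicPart_stable`** — when every `g ∈ G` factors as
  `ι a * c` with `ρ c` commuting with `ρ (ι a')` for all `a'` («G(𝔸) = G_∞ · G(𝔸_f)»), every
  `isotypicPart (ρ.comp ι) σ` is `ρ`-stable;
* **`existsUnique_le_isotypicPart`**: the two assembled — for the canonical isotypic parts, under
  the factorisation hypothesis and density, a `ρ`-irreducible `W₀ ≠ ⊥` lies in exactly one of them.

Imports row 37 (and rows 31 / 33 / 35 / 32 through it).  Axioms: propext, Classical.choice,
Quot.sound.  README §8(d): uses an L-value-free non-vanishing device: NO.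
-/

namespace Summit.Ventures.HodgeRepro2.T5IsotypicStep4Adelic

open ContinuousLinearMap
open scoped InnerProductSpace
open Summit.Ventures.HodgeRepro2.T5SchurIsotypicStep4
  (exists_restrictRep stable_topologicalClosure symm_apply_restrict
    exists_starProjection_ne_zero_of_dense le_of_forall_starProjection_eq_zero)

variable {E : Type*} [NormedAddCommGroup E] [InnerProductSpace ℂ E] [CompleteSpace E]
variable {G A : Type*} [Group G] [Group A]

/-! ### Restriction along `ι : A →* G` -/

/-- The restriction `ρ ∘ ι` of a unitary representation along a homomorphism is unitary. -/
theorem star_comp_eq {ρ : G →* (E →L[ℂ] E)} (hρ : ∀ g, star (ρ g) = ρ g⁻¹) (ι : A →* G)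
    (a : A) : star ((ρ.comp ι) a) = (ρ.comp ι) a⁻¹ := by
  simp only [MonoidHom.comp_apply, map_inv, hρ]

section Isotypic

variable {P : Type*} {F : P → Type*} [∀ π, NormedAddCommGroup (F π)]
  [∀ π, InnerProductSpace ℂ (F π)] [∀ π, CompleteSpace (F π)]

/-- **STEP 4, the comparison, two-group form.**  `ρ` unitary on `E` for the big group `G`; the
`A`-isotypic parts `L π = closure (⨆ i, H π i)` (copies `H π i` of the pairwise inequivalent
irreducible unitary `σ π : A →* …`, stable under `ρ ∘ ι`), each `L π` being `ρ`-stable ((α),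
`hLs`); `W₀` closed and irreducible under `ρ`.  If `P_{L π}` and `P_{L π'}` are both non-zero on
`W₀`, then `σ π ≅ σ π'`. -/
theorem exists_linearIsometryEquiv_of_starProjection_ne_zero_big {ρ : G →* (E →L[ℂ] E)}
    (hρ : ∀ g, star (ρ g) = ρ g⁻¹) (ι : A →* G)
    (σ : ∀ π, A →* (F π →L[ℂ] F π)) (hσ : ∀ π a, star (σ π a) = σ π a⁻¹)
    (hσirr : ∀ π, ∀ V : Submodule ℂ (F π), IsClosed (V : Set (F π)) →
      (∀ a, ∀ v ∈ V, σ π a v ∈ V) → V = ⊥ ∨ V = ⊤)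
    {ιx : P → Type*} (H : ∀ π, ιx π → Submodule ℂ E) (hHc : ∀ π i, IsClosed (H π i : Set E))
    (hHs : ∀ π i a, ∀ x ∈ H π i, ρ (ι a) x ∈ H π i)
    (U : ∀ π i, F π ≃ₗᵢ[ℂ] H π i) (hU : ∀ π i a x, ((U π i) (σ π a x) : E) = ρ (ι a) (U π i x))
    (hLs : ∀ π g, ∀ x ∈ (⨆ i, H π i).topologicalClosure,
      ρ g x ∈ (⨆ i, H π i).topologicalClosure)
    {W₀ : Submodule ℂ E} (hW₀c : IsClosed (W₀ : Set E))
    (ρW₀ : G →* (W₀ →L[ℂ] W₀)) (hρW₀ : ∀ g (w : W₀), (ρW₀ g w : E) = ρ g w)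
    (hW₀irr : ∀ C : Submodule ℂ W₀, IsClosed (C : Set W₀) →
      (∀ g, ∀ x ∈ C, ρW₀ g x ∈ C) → C = ⊥ ∨ C = ⊤)
    {π π' : P}
    (hπ : ∃ w ∈ W₀, ((⨆ i, H π i).topologicalClosure).starProjection w ≠ 0)
    (hπ' : ∃ w ∈ W₀, ((⨆ i, H π' i).topologicalClosure).starProjection w ≠ 0) :
    ∃ (t : ℝ) (V : F π ≃ₗᵢ[ℂ] F π'), 0 < t ∧ ∀ a x, V (σ π a x) = σ π' a (V x) := by
  haveI : CompleteSpace W₀ := hW₀c.completeSpace_coe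
  have hρW₀' : ∀ g, star (ρW₀ g) = ρW₀ g⁻¹ :=
    T5SchurIsotypicCopy.star_eq_of_coe_eq hρ hW₀c ρW₀ hρW₀
  have hρι : ∀ a, star ((ρ.comp ι) a) = (ρ.comp ι) a⁻¹ := star_comp_eq hρ ι
  have hHs' : ∀ π i a, ∀ x ∈ H π i, (ρ.comp ι) a x ∈ H π i := hHs
  have hU' : ∀ π i a x, ((U π i) (σ π a x) : E) = (ρ.comp ι) a (U π i x) := hU
  -- a non-zero projection to `L q` realises `W₀` inside `L q` as a closed `ρ`-stable subspace
  have key : ∀ (q : P), (∃ w ∈ W₀, ((⨆ i, H q i).topologicalClosure).starProjection w ≠ 0) →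
      ∃ (R : Submodule ℂ E) (ρR : A →* (R →L[ℂ] R)) (UR : W₀ ≃ₗᵢ[ℂ] R),
        IsClosed (R : Set E) ∧ R ≤ (⨆ i, H q i).topologicalClosure ∧ R ≠ ⊥ ∧
        (∀ a (w : R), (ρR a w : E) = (ρ.comp ι) a w) ∧
        ∀ g x, (UR (ρW₀ g x) : E) = ρ g (UR x) := by
    intro q ⟨w, hwW, hw⟩
    set Lq : Submodule ℂ E := (⨆ i, H q i).topologicalClosure with hLq
    have hLqc : IsClosed (Lq : Set E) := Submodule.isClosed_topologicalClosure _
    haveI : CompleteSpace Lq := hLqc.completeSpace_coe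
    -- `A = P_{L q} ∘ (W₀ ↪ E)`, an intertwiner `ρW₀ → ρ` for the BIG group, by (α)
    let A₀ : W₀ →L[ℂ] E := Lq.starProjection ∘L W₀.subtypeL
    have hA : ∀ g, A₀ ∘L ρW₀ g = ρ g ∘L A₀ := by
      intro g
      ext x
      simp only [A₀, comp_apply, Submodule.subtypeL_apply, hρW₀]
      have := DFunLike.congr_fun (T5SchurIff.starProjection_comm hρ hLqc (hLs q) g) (x : E)
      simpa only [comp_apply] using this
    have hA0 : A₀ ≠ 0 := by
      intro h
      have := DFunLike.congr_fun h ⟨w, hwW⟩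
      simp only [A₀, comp_apply, Submodule.subtypeL_apply, zero_apply] at this
      exact hw this
    obtain ⟨t, UR, ht, -, hUR⟩ :=
      T5SchurIntertwiner.exists_linearIsometryEquiv_range hρW₀' hρ hW₀irr hA hA0
    obtain ⟨t₀, ht₀, hAt₀⟩ :=
      T5SchurIntertwiner.exists_pos_adjoint_comp_self_eq_smul_one hρW₀' hρ hW₀irr hA hA0
    have hRs : ∀ g, ∀ y ∈ LinearMap.range (A₀ : W₀ →ₗ[ℂ] E),
        ρ g y ∈ LinearMap.range (A₀ : W₀ →ₗ[ℂ] E) := T5SchurIntertwiner.range_stable hA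
    have hRs' : ∀ a, ∀ y ∈ LinearMap.range (A₀ : W₀ →ₗ[ℂ] E),
        (ρ.comp ι) a y ∈ LinearMap.range (A₀ : W₀ →ₗ[ℂ] E) := fun a => hRs (ι a)
    obtain ⟨ρR, hρR⟩ := exists_restrictRep (ρ.comp ι) hRs'
    refine ⟨LinearMap.range (A₀ : W₀ →ₗ[ℂ] E), ρR, UR,
      T5SchurIntertwiner.isClosed_range_coe ht₀ hAt₀, ?_, ?_, hρR, hUR⟩
    · rintro _ ⟨x, rfl⟩
      exact Lq.starProjection_apply_mem _
    · intro hbot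
      apply hA0
      have h0 : (A₀ : W₀ →ₗ[ℂ] E) = 0 := LinearMap.range_eq_bot.mp hbot
      exact ContinuousLinearMap.coe_injective (by rw [h0]; rfl)
  obtain ⟨R, ρR, UR, hRc, hRle, hR0, hρR, hUR⟩ := key π hπ
  obtain ⟨R', ρR', UR', hR'c, hR'le, -, hρR', hUR'⟩ := key π' hπ'
  -- restricted along `ι`, the two realisations are `A`-equivalent: compare the copies (row 35)
  have hUR₁ : ∀ a x, (UR ((ρW₀.comp ι) a x) : E) = (ρ.comp ι) a (UR x) := fun a x => hUR (ι a) x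
  refine T5SchurIsotypicUnique.exists_linearIsometryEquiv_of_equiv hρι (hσ π) (hσirr π) (hσ π')
    (hσirr π') (H π) (hHc π) (hHs' π) (U π) (hU' π) (H π') (hHc π') (hHs' π') (U π') (hU' π')
    hRc hRle hR'le hR0 ρR hρR ρR' hρR' (UR.symm.trans UR') fun a x => ?_
  rw [LinearIsometryEquiv.trans_apply, LinearIsometryEquiv.trans_apply,
    symm_apply_restrict (ρW₀.comp ι) ρR hρR UR hUR₁ a x]
  apply Subtype.ext
  rw [hρR']
  exact hUR' (ι a) _

/-- **STEP 4, uniqueness, two-group form**: for pairwise inequivalent `σ π` whose `A`-isotypic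
parts have dense span and are `ρ`-stable, EXACTLY ONE `π` has a non-zero projection `P_{L π}` on the
`ρ`-irreducible `W₀ ≠ ⊥`. -/
theorem existsUnique_starProjection_ne_zero_big {ρ : G →* (E →L[ℂ] E)}
    (hρ : ∀ g, star (ρ g) = ρ g⁻¹) (ι : A →* G)
    (σ : ∀ π, A →* (F π →L[ℂ] F π)) (hσ : ∀ π a, star (σ π a) = σ π a⁻¹)
    (hσirr : ∀ π, ∀ V : Submodule ℂ (F π), IsClosed (V : Set (F π)) →
      (∀ a, ∀ v ∈ V, σ π a v ∈ V) → V = ⊥ ∨ V = ⊤)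
    (hne : ∀ π π', π ≠ π' → ∀ V : F π ≃ₗᵢ[ℂ] F π', ¬ ∀ a x, V (σ π a x) = σ π' a (V x))
    {ιx : P → Type*} (H : ∀ π, ιx π → Submodule ℂ E) (hHc : ∀ π i, IsClosed (H π i : Set E))
    (hHs : ∀ π i a, ∀ x ∈ H π i, ρ (ι a) x ∈ H π i)
    (U : ∀ π i, F π ≃ₗᵢ[ℂ] H π i) (hU : ∀ π i a x, ((U π i) (σ π a x) : E) = ρ (ι a) (U π i x))
    (hLs : ∀ π g, ∀ x ∈ (⨆ i, H π i).topologicalClosure,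
      ρ g x ∈ (⨆ i, H π i).topologicalClosure)
    (hdense : (⨆ π, (⨆ i, H π i).topologicalClosure).topologicalClosure = ⊤)
    {W₀ : Submodule ℂ E} (hW₀c : IsClosed (W₀ : Set E)) (hW₀0 : W₀ ≠ ⊥)
    (ρW₀ : G →* (W₀ →L[ℂ] W₀)) (hρW₀ : ∀ g (w : W₀), (ρW₀ g w : E) = ρ g w)
    (hW₀irr : ∀ C : Submodule ℂ W₀, IsClosed (C : Set W₀) →
      (∀ g, ∀ x ∈ C, ρW₀ g x ∈ C) → C = ⊥ ∨ C = ⊤) :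
    ∃! π, ∃ w ∈ W₀, ((⨆ i, H π i).topologicalClosure).starProjection w ≠ 0 := by
  obtain ⟨π, hπ⟩ := exists_starProjection_ne_zero_of_dense H hdense hW₀0
  refine ⟨π, hπ, fun π' hπ' => ?_⟩
  by_contra hne'
  obtain ⟨t, V, ht, hV⟩ := exists_linearIsometryEquiv_of_starProjection_ne_zero_big hρ ι σ hσ
    hσirr H hHc hHs U hU hLs hW₀c ρW₀ hρW₀ hW₀irr hπ' hπ
  exact hne π' π hne' V hV

/-- **(A3) STEP 4 with the hypotheses of the prose: «π₀ ⊂ L_{π_∞}».**  `ρ` unitary on `E` for the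
group `G` («G(𝔸)»), `ι : A →* G` («G_∞ ⊂ G(𝔸)»), the `A`-isotypic parts `L π = closure (⨆ i, H π i)`
of pairwise inequivalent irreducible unitary `σ π` with dense span, each `ρ`-stable ((α));
a closed `ρ`-stable `W₀ ≠ ⊥` («π₀») irreducible under `ρ` lies in EXACTLY ONE `L π`. -/
theorem existsUnique_le_isotypic_big {ρ : G →* (E →L[ℂ] E)}
    (hρ : ∀ g, star (ρ g) = ρ g⁻¹) (ι : A →* G)
    (σ : ∀ π, A →* (F π →L[ℂ] F π)) (hσ : ∀ π a, star (σ π a) = σ π a⁻¹)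
    (hσirr : ∀ π, ∀ V : Submodule ℂ (F π), IsClosed (V : Set (F π)) →
      (∀ a, ∀ v ∈ V, σ π a v ∈ V) → V = ⊥ ∨ V = ⊤)
    (hne : ∀ π π', π ≠ π' → ∀ V : F π ≃ₗᵢ[ℂ] F π', ¬ ∀ a x, V (σ π a x) = σ π' a (V x))
    {ιx : P → Type*} (H : ∀ π, ιx π → Submodule ℂ E) (hHc : ∀ π i, IsClosed (H π i : Set E))
    (hHs : ∀ π i a, ∀ x ∈ H π i, ρ (ι a) x ∈ H π i)
    (U : ∀ π i, F π ≃ₗᵢ[ℂ] H π i) (hU : ∀ π i a x, ((U π i) (σ π a x) : E) = ρ (ι a) (U π i x))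
    (hLs : ∀ π g, ∀ x ∈ (⨆ i, H π i).topologicalClosure,
      ρ g x ∈ (⨆ i, H π i).topologicalClosure)
    (hdense : (⨆ π, (⨆ i, H π i).topologicalClosure).topologicalClosure = ⊤)
    {W₀ : Submodule ℂ E} (hW₀c : IsClosed (W₀ : Set E)) (hW₀0 : W₀ ≠ ⊥)
    (ρW₀ : G →* (W₀ →L[ℂ] W₀)) (hρW₀ : ∀ g (w : W₀), (ρW₀ g w : E) = ρ g w)
    (hW₀irr : ∀ C : Submodule ℂ W₀, IsClosed (C : Set W₀) →
      (∀ g, ∀ x ∈ C, ρW₀ g x ∈ C) → C = ⊥ ∨ C = ⊤) :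
    ∃! π, W₀ ≤ (⨆ i, H π i).topologicalClosure := by
  have hρι : ∀ a, star ((ρ.comp ι) a) = (ρ.comp ι) a⁻¹ := star_comp_eq hρ ι
  have hHs' : ∀ π i a, ∀ x ∈ H π i, (ρ.comp ι) a x ∈ H π i := hHs
  have hU' : ∀ π i a x, ((U π i) (σ π a x) : E) = (ρ.comp ι) a (U π i x) := hU
  -- pairwise orthogonality of the `A`-isotypic parts (STEP 3 (β), row 35)
  have horth : Pairwise fun π π' =>
      (⨆ i, H π i).topologicalClosure ⟂ (⨆ i, H π' i).topologicalClosure := fun π π' hπ =>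
    T5SchurIsotypicUnique.isOrtho_closure_iSup_of_not_equiv hρι (hσ π) (hσirr π) (hσ π')
      (hσirr π') (H π) (U π) (hU' π) (H π') (hHc π') (hHs' π') (U π') (hU' π') (hne π π' hπ)
  obtain ⟨π, hπ, huniq⟩ := existsUnique_starProjection_ne_zero_big hρ ι σ hσ hσirr hne H hHc hHs
    U hU hLs hdense hW₀c hW₀0 ρW₀ hρW₀ hW₀irr
  refine ⟨π, ?_, fun π' hπ' => ?_⟩
  · refine le_of_forall_starProjection_eq_zero (fun π => Submodule.isClosed_topologicalClosure _)
      horth hdense fun π' hπ' w hw => ?_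
    by_contra hne'
    exact hπ' (huniq π' ⟨w, hw, hne'⟩)
  · by_contra hne'
    obtain ⟨w', hw'W, hw'⟩ := hπ
    haveI : CompleteSpace ((⨆ i, H π i).topologicalClosure) :=
      (Submodule.isClosed_topologicalClosure _).completeSpace_coe
    apply hw'
    have hmem : w' ∈ ((⨆ i, H π i).topologicalClosure)ᗮ := (horth hne').le (hπ' hw'W)
    exact (Submodule.starProjection_apply_eq_zero_iff _).mpr hmem

end Isotypic

/-! ### (α): the canonical isotypic part is stable under everything commuting with `A` -/

section Canonical

variable {F : Type*} [NormedAddCommGroup F] [InnerProductSpace ℂ F]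

omit [CompleteSpace E] in
/-- The closed `ρA`-stable copies of `σ` inside `E`: closed `ρA`-stable subspaces `W` with an
intertwining isometry `F ≃ₗᵢ[ℂ] W`. -/
def copies (ρA : A →* (E →L[ℂ] E)) (σ : A →* (F →L[ℂ] F)) : Set (Submodule ℂ E) :=
  {W | IsClosed (W : Set E) ∧ (∀ a, ∀ x ∈ W, ρA a x ∈ W) ∧
    ∃ V : F ≃ₗᵢ[ℂ] W, ∀ a x, (V (σ a x) : E) = ρA a (V x)}

omit [CompleteSpace E] in
/-- The canonical `σ`-isotypic part of `ρA`: the closed span of ALL closed stable copies of `σ`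
(«L_π», STEP 3). -/
def isotypicPart (ρA : A →* (E →L[ℂ] E)) (σ : A →* (F →L[ℂ] F)) : Submodule ℂ E :=
  (sSup (copies ρA σ)).topologicalClosure

omit [CompleteSpace E] in
/-- The canonical isotypic part in the indexed form of rows 37 / 76 (index type: the copies). -/
theorem isotypicPart_eq (ρA : A →* (E →L[ℂ] E)) (σ : A →* (F →L[ℂ] F)) :
    isotypicPart ρA σ =
      (⨆ W : copies ρA σ, (W : Submodule ℂ E)).topologicalClosure := by
  rw [isotypicPart, sSup_eq_iSup']

/-- The operator `ρ g` of a unitary representation as a linear isometry equivalence of `E`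
(inverse `ρ g⁻¹`). -/
noncomputable def unitaryEquiv (ρ : G →* (E →L[ℂ] E)) (hρ : ∀ g, star (ρ g) = ρ g⁻¹) (g : G) :
    E ≃ₗᵢ[ℂ] E :=
  LinearEquiv.isometryOfInner
    (LinearEquiv.ofLinear (ρ g : E →ₗ[ℂ] E) (ρ g⁻¹ : E →ₗ[ℂ] E)
      (by ext x; simp only [LinearMap.comp_apply, ContinuousLinearMap.coe_coe, LinearMap.id_apply,
        ← mul_apply_eq_comp, ← map_mul, mul_inv_cancel, map_one, one_apply_eq_self])
      (by ext x; simp only [LinearMap.comp_apply, ContinuousLinearMap.coe_coe, LinearMap.id_apply,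
        ← mul_apply_eq_comp, ← map_mul, inv_mul_cancel, map_one, one_apply_eq_self]))
    (fun x y => T5SchurIsotypicStep4.inner_map_map_of_star_eq hρ g x y)

/-- `unitaryEquiv ρ hρ g x = ρ g x`. -/
@[simp] theorem unitaryEquiv_apply (ρ : G →* (E →L[ℂ] E)) (hρ : ∀ g, star (ρ g) = ρ g⁻¹) (g : G)
    (x : E) : unitaryEquiv ρ hρ g x = ρ g x := rfl

omit [CompleteSpace E] in
/-- A linear isometry equivalence `T` of `E` restricts to a linear isometry equivalence
`W ≃ₗᵢ[ℂ] W.map T`. -/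
noncomputable def mapIsometryEquiv (T : E ≃ₗᵢ[ℂ] E) (W : Submodule ℂ E) :
    W ≃ₗᵢ[ℂ] W.map (T : E →ₗ[ℂ] E) :=
  LinearEquiv.isometryOfInner (T.toLinearEquiv.submoduleMap W) (by
    intro x y
    change ⟪T x, T y⟫_ℂ = ⟪(x : E), y⟫_ℂ
    exact T.inner_map_map x y)

omit [CompleteSpace E] in
/-- `mapIsometryEquiv T W x = T x`. -/
@[simp] theorem coe_mapIsometryEquiv_apply (T : E ≃ₗᵢ[ℂ] E) (W : Submodule ℂ E) (x : W) :
    (mapIsometryEquiv T W x : E) = T x := rfl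

omit [CompleteSpace E] in
/-- **A unitary commuting with `ρA` maps copies of `σ` to copies of `σ`** («R(g) […] maps such
subspaces to such subspaces»). -/
theorem map_mem_copies {ρA : A →* (E →L[ℂ] E)} {σ : A →* (F →L[ℂ] F)} (T : E ≃ₗᵢ[ℂ] E)
    (hT : ∀ a x, T (ρA a x) = ρA a (T x)) {W : Submodule ℂ E} (hW : W ∈ copies ρA σ) :
    W.map (T : E →ₗ[ℂ] E) ∈ copies ρA σ := by
  obtain ⟨hWc, hWs, V, hV⟩ := hW
  refine ⟨?_, ?_, V.trans (mapIsometryEquiv T W), ?_⟩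
  · rw [Submodule.map_coe]
    exact (T.toHomeomorph.isClosed_image).mpr hWc
  · intro a x hx
    obtain ⟨w, hw, rfl⟩ := Submodule.mem_map.mp hx
    exact Submodule.mem_map.mpr ⟨ρA a w, hWs a w hw, by
      change T (ρA a w) = ρA a (T w)
      exact hT a w⟩
  · intro a x
    simp only [LinearIsometryEquiv.trans_apply, coe_mapIsometryEquiv_apply, hV, hT]

omit [CompleteSpace E] in
/-- **(α) for one commuting unitary**: the canonical isotypic part is stable under every linear
isometry equivalence commuting with `ρA`. -/
theorem isotypicPart_stable_of_comm {ρA : A →* (E →L[ℂ] E)} {σ : A →* (F →L[ℂ] F)}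
    (T : E ≃ₗᵢ[ℂ] E) (hT : ∀ a x, T (ρA a x) = ρA a (T x)) :
    ∀ x ∈ isotypicPart ρA σ, T x ∈ isotypicPart ρA σ := by
  intro x hx
  rw [isotypicPart_eq] at hx ⊢
  have hstab : ∀ y ∈ (⨆ W : copies ρA σ, (W : Submodule ℂ E)),
      T y ∈ (⨆ W : copies ρA σ, (W : Submodule ℂ E)) := by
    intro y hy
    refine Submodule.iSup_induction (fun W : copies ρA σ => (W : Submodule ℂ E))
      (motive := fun y => T y ∈ ⨆ W : copies ρA σ, (W : Submodule ℂ E)) hy ?_ ?_ ?_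
    · intro W y hy
      exact Submodule.mem_iSup_of_mem ⟨(W : Submodule ℂ E).map (T : E →ₗ[ℂ] E),
        map_mem_copies T hT W.2⟩ (Submodule.mem_map_of_mem hy)
    · simp
    · intro y z hy hz
      rw [map_add]
      exact Submodule.add_mem _ hy hz
  exact map_mem_closure T.continuous hx hstab

/-- **(α): «L_π is G(𝔸)-stable».**  If every `g ∈ G` factors as `g = ι a * c` with `ρ c` commuting
with every `ρ (ι a')` («G(𝔸) = G_∞ · G(𝔸_f)»), then every canonical `A`-isotypic part of the unitary
`ρ` is `ρ`-stable. -/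
theorem isotypicPart_stable {ρ : G →* (E →L[ℂ] E)} (hρ : ∀ g, star (ρ g) = ρ g⁻¹) (ι : A →* G)
    (hgen : ∀ g : G, ∃ (a : A) (c : G), g = ι a * c ∧ ∀ a', ρ c * ρ (ι a') = ρ (ι a') * ρ c)
    (σ : A →* (F →L[ℂ] F)) (g : G) :
    ∀ x ∈ isotypicPart (ρ.comp ι) σ, ρ g x ∈ isotypicPart (ρ.comp ι) σ := by
  intro x hx
  obtain ⟨a, c, rfl, hc⟩ := hgen g
  rw [map_mul, mul_apply_eq_comp]
  -- `ρ c` preserves the isotypic part (it commutes with `A` and maps copies to copies)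
  have hcx : ρ c x ∈ isotypicPart (ρ.comp ι) σ := by
    have hT : ∀ a' y, unitaryEquiv ρ hρ c ((ρ.comp ι) a' y) = (ρ.comp ι) a' (unitaryEquiv ρ hρ c y) := by
      intro a' y
      simp only [unitaryEquiv_apply, MonoidHom.comp_apply, ← mul_apply_eq_comp, hc a']
    exact isotypicPart_stable_of_comm (unitaryEquiv ρ hρ c) hT x hx
  -- `ρ (ι a)` preserves every copy, hence their closed span
  rw [isotypicPart_eq] at hcx ⊢
  exact stable_topologicalClosure (ρ := ρ.comp ι) (H := fun W : copies (ρ.comp ι) σ => (W : Submodule ℂ E))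
    (fun W a' => W.2.2.1 a') a _ hcx

end Canonical

/-! ### STEP 4 for the canonical isotypic parts -/

section Assembled

variable {P : Type*} {F : P → Type*} [∀ π, NormedAddCommGroup (F π)]
  [∀ π, InnerProductSpace ℂ (F π)] [∀ π, CompleteSpace (F π)]

/-- **(A3) STEP 4 assembled for the canonical isotypic parts.**  `ρ` unitary on `E` for `G`,
`ι : A →* G` with `G = ι(A) · C_G(ι(A))` in the operator sense (`hgen`), `σ π` pairwise
inequivalent irreducible unitary representations of `A`, the canonical isotypic parts
`isotypicPart (ρ.comp ι) (σ π)` with dense span; a closed `ρ`-stable `W₀ ≠ ⊥` irreducible under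
`ρ` lies in EXACTLY ONE canonical isotypic part: «π₀ ⊂ L_{π_∞}». -/
theorem existsUnique_le_isotypicPart {ρ : G →* (E →L[ℂ] E)}
    (hρ : ∀ g, star (ρ g) = ρ g⁻¹) (ι : A →* G)
    (hgen : ∀ g : G, ∃ (a : A) (c : G), g = ι a * c ∧ ∀ a', ρ c * ρ (ι a') = ρ (ι a') * ρ c)
    (σ : ∀ π, A →* (F π →L[ℂ] F π)) (hσ : ∀ π a, star (σ π a) = σ π a⁻¹)
    (hσirr : ∀ π, ∀ V : Submodule ℂ (F π), IsClosed (V : Set (F π)) →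
      (∀ a, ∀ v ∈ V, σ π a v ∈ V) → V = ⊥ ∨ V = ⊤)
    (hne : ∀ π π', π ≠ π' → ∀ V : F π ≃ₗᵢ[ℂ] F π', ¬ ∀ a x, V (σ π a x) = σ π' a (V x))
    (hdense : (⨆ π, isotypicPart (ρ.comp ι) (σ π)).topologicalClosure = ⊤)
    {W₀ : Submodule ℂ E} (hW₀c : IsClosed (W₀ : Set E)) (hW₀0 : W₀ ≠ ⊥)
    (ρW₀ : G →* (W₀ →L[ℂ] W₀)) (hρW₀ : ∀ g (w : W₀), (ρW₀ g w : E) = ρ g w)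
    (hW₀irr : ∀ C : Submodule ℂ W₀, IsClosed (C : Set W₀) →
      (∀ g, ∀ x ∈ C, ρW₀ g x ∈ C) → C = ⊥ ∨ C = ⊤) :
    ∃! π, W₀ ≤ isotypicPart (ρ.comp ι) (σ π) := by
  have heq : ∀ π, isotypicPart (ρ.comp ι) (σ π) =
      (⨆ W : copies (ρ.comp ι) (σ π), (W : Submodule ℂ E)).topologicalClosure :=
    fun π => isotypicPart_eq _ _
  have hLs : ∀ π g, ∀ x ∈ (⨆ W : copies (ρ.comp ι) (σ π), (W : Submodule ℂ E)).topologicalClosure,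
      ρ g x ∈ (⨆ W : copies (ρ.comp ι) (σ π), (W : Submodule ℂ E)).topologicalClosure := by
    intro π g x hx
    rw [← heq] at hx ⊢
    exact isotypicPart_stable hρ ι hgen (σ π) g x hx
  have hdense' : (⨆ π, (⨆ W : copies (ρ.comp ι) (σ π),
      (W : Submodule ℂ E)).topologicalClosure).topologicalClosure = ⊤ := by
    simp only [← heq]
    exact hdense
  have key := existsUnique_le_isotypic_big hρ ι σ hσ hσirr hne
    (fun π (W : copies (ρ.comp ι) (σ π)) => (W : Submodule ℂ E))
    (fun π W => W.2.1) (fun π W a => W.2.2.1 a)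
    (fun π W => Classical.choose W.2.2.2) (fun π W => Classical.choose_spec W.2.2.2)
    hLs hdense' hW₀c hW₀0 ρW₀ hρW₀ hW₀irr
  simpa only [← heq] using key

end Assembled

end Summit.Ventures.HodgeRepro2.T5IsotypicStep4Adelic
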